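import Summits.Schanuel.Schanuel.Theorems.ZilberEacRealSplitLevel
import Summits.Schanuel.Schanuel.Theorems.ZilberEacRealSplitCoreShift
import Mathlib.NumberTheory.Real.Irrational
import HarnessLib

/-!
# Totally real plane × graph curve in `ℂ³ × ℂ³`: the exponential points are ZARISKI DENSE

Zilber's Exponential-Algebraic Closedness, case ladder (host summit Schanuel, cell `pub-schanuel`,
seat 2, gen 7).

**THEOREM (`unprojectedDense_realSplit_two`).**  Let `r₀, r₁ ∈ ℝ` with `r₁` irrational, `c ∈ ℂ`,
and nonzero `q₀, q₁ ∈ ℂ[u]` with `r₀ deg q₀ + r₁ deg q₁ ≠ 1`.  Then the exponential points of the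
3-fold `W = {x₂ = r₀ x₀ + r₁ x₁ + c, y₀ = q₀(y₂), y₁ = q₁(y₂)} ⊆ ℂ³ × ℂ³` are Zariski dense in `W`:
`I(W ∩ Γ_exp) = I(W)` (`UnprojectedDense W`).  For `1, r₀, r₁` linearly independent over `ℚ` and
`q` generic these are members of the APERIODIC piece of the first open cell `EC(3,2)`; e.g.
`{x₂ = √2 x₀ + √3 x₁, y₀ = y₂ + 1, y₁ = y₂² - 2}` (`unprojectedDense_sqrt_two_sqrt_three_split`).

This is the first unconditional Zariski-density statement in the tree for 3-fold members of the
open cell itself (seat 2 gen 6's `unprojectedDense_of_ecCell_succ` is conditional on a higher cell;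
the `n = 2` density files concern Mantova–Masser's question one dimension down).  In print: EC for
`L × W` is Gallinaro 2023 Thm 8.8 (existence); density of exponential points is asserted only
conditionally (Aslanyan–Gallinaro 2024 Rem. 3.5, from EC one dimension up).  HONEST FRAMING: an
explicit family, not the cell; nothing here bears on Schanuel's conjecture; `ECCell 3 2` OPEN.

## Proof

Points of `W` are parametrised by `(x₀, x₁, u = y₂)`; a polynomial `F` vanishing on `W ∩ Γ_exp`
pulls back to `G ∈ ℂ[u][x₀][x₁]`.  By `realSplit_core_shift` (with the escaping coordinate
`j₀ = 1` and a prescribed shift `2πik` in `x₀`), for every `α` in an infinite set `A`, every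
`k ∈ ℤ`, there are exponential points with `u → α`, `x₀ → Λ₀(α) + 2πik`, `|x₁| → ∞`; hence the
leading `x₁`-coefficient of `G` vanishes at `(α, Λ₀(α) + 2πik)`
(`map_leadingCoeff_eq_zero_of_eval₂_eq_zero`, a limit form of
`EACDensityOscillatory.tendsto_norm_leadingCoeff_eval`), i.e. for each `α ∈ A` at infinitely many
`x₀`, so it is zero (`eq_zero_of_forall_mmEval_shift_eq_zero`); thus `G = 0` and `F ∈ I(W)`.
-/

noncomputable section

open MvPolynomial Filter Topology Complex Metric
open Literature.NumberTheory.Transcendental Literature.ModelTheory.Zilber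
  Literature.ModelTheory.ExponentialFields

set_option linter.dupNamespace false

namespace Summit.Schanuel.Schanuel.Theorems

section Elimination

/-- **The leading coefficient dies (limit form).** Let `G ∈ R[z]` and ring maps `φₙ, φ : R → ℂ`
with `φₙ(a) → φ(a)` for every `a`.  If `G` vanishes at `(φₙ, zₙ)` with `|zₙ| → ∞` then
`φ(lc G) = 0`. -/
theorem map_leadingCoeff_eq_zero_of_eval₂_eq_zero {R : Type*} [CommRing R] (G : Polynomial R)
    (φ : ℕ → R →+* ℂ) (φ₀ : R →+* ℂ) (hφ : ∀ a, Tendsto (fun n => φ n a) atTop (𝓝 (φ₀ a)))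
    (z : ℕ → ℂ) (hz : Tendsto (fun n => ‖z n‖) atTop atTop)
    (hG : ∀ n, G.eval₂ (φ n) (z n) = 0) : φ₀ G.leadingCoeff = 0 := by
  by_contra hne
  set N := G.natDegree with hN
  set η : ℝ := ‖φ₀ G.leadingCoeff‖ / 2 with hη
  have hη0 : 0 < η := by positivity
  set M : ℝ := ∑ i ∈ Finset.range N, (‖φ₀ (G.coeff i)‖ + 1) with hM
  have hM0 : 0 ≤ M := Finset.sum_nonneg fun i _ => by positivity
  -- eventually: the lower coefficients are bounded, the top one is bounded below
  have hlow : ∀ᶠ n in atTop, ∀ i ∈ Finset.range N, ‖φ n (G.coeff i)‖ ≤ ‖φ₀ (G.coeff i)‖ + 1 := by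
    refine (Finset.eventually_all _).2 fun i _ => ?_
    have h1 : Tendsto (fun n => ‖φ n (G.coeff i)‖) atTop (𝓝 ‖φ₀ (G.coeff i)‖) := (hφ _).norm
    exact (h1.eventually (gt_mem_nhds (lt_add_one _))).mono fun n hn => hn.le
  have htop : ∀ᶠ n in atTop, η ≤ ‖φ n G.leadingCoeff‖ := by
    have h1 : Tendsto (fun n => ‖φ n G.leadingCoeff‖) atTop (𝓝 ‖φ₀ G.leadingCoeff‖) :=
      (hφ _).norm
    have h2 : η < ‖φ₀ G.leadingCoeff‖ := by
      rw [hη]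
      linarith [norm_pos_iff.2 hne]
    exact (h1.eventually (lt_mem_nhds h2)).mono fun n hn => hn.le
  have hbig : ∀ᶠ n in atTop, M / η + 1 ≤ ‖z n‖ := hz.eventually_ge_atTop _
  have hone : ∀ᶠ n in atTop, (1 : ℝ) ≤ ‖z n‖ := hz.eventually_ge_atTop _
  obtain ⟨n, hn⟩ := (((hlow.and htop).and hbig).and hone).exists
  obtain ⟨⟨⟨hlow', htop'⟩, hbig'⟩, hone'⟩ := hn
  -- the equation at `n`
  have heq : φ n G.leadingCoeff * z n ^ N =
      -∑ i ∈ Finset.range N, φ n (G.coeff i) * z n ^ i := by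
    have h := hG n
    rw [Polynomial.eval₂_eq_sum_range, Finset.sum_range_succ] at h
    rw [Polynomial.leadingCoeff]
    linear_combination h
  rcases Nat.eq_zero_or_pos N with hN0 | hNpos
  · -- constant polynomial: `φ n lc = 0`, contradicting `η ≤ ‖φ n lc‖`
    rw [hN0] at heq
    simp only [pow_zero, mul_one, Finset.range_zero, Finset.sum_empty, neg_zero] at heq
    rw [heq, norm_zero] at htop'
    exact absurd htop' (not_le.2 hη0)
  · have hzpos : 0 < ‖z n‖ := one_pos.trans_le hone'
    have hbound : ‖φ n G.leadingCoeff‖ * ‖z n‖ ^ N ≤ M * ‖z n‖ ^ (N - 1) := by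
      rw [← norm_pow, ← norm_mul, heq, norm_neg, hM, Finset.sum_mul]
      refine (norm_sum_le _ _).trans (Finset.sum_le_sum fun i hi => ?_)
      rw [norm_mul, norm_pow]
      refine mul_le_mul (hlow' i hi) ?_ (pow_nonneg (norm_nonneg _) _) (by positivity)
      exact pow_le_pow_right₀ hone' (Nat.le_sub_one_of_lt (Finset.mem_range.mp hi))
    obtain ⟨N', hN'⟩ : ∃ N', N = N' + 1 := ⟨N - 1, by omega⟩
    rw [hN', pow_succ, Nat.add_sub_cancel] at hbound
    have hzN : 0 < ‖z n‖ ^ N' := pow_pos hzpos _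
    have h1 : ‖φ n G.leadingCoeff‖ * ‖z n‖ ≤ M := by
      have h2 : (‖φ n G.leadingCoeff‖ * ‖z n‖) * ‖z n‖ ^ N' ≤ M * ‖z n‖ ^ N' := by
        calc (‖φ n G.leadingCoeff‖ * ‖z n‖) * ‖z n‖ ^ N'
            = ‖φ n G.leadingCoeff‖ * (‖z n‖ ^ N' * ‖z n‖) := by ring
          _ ≤ M * ‖z n‖ ^ N' := hbound
      exact le_of_mul_le_mul_right h2 hzN
    have h3 : η * ‖z n‖ ≤ M := (mul_le_mul_of_nonneg_right htop' (norm_nonneg _)).trans h1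
    have h4 : η * (M / η + 1) ≤ η * ‖z n‖ := mul_le_mul_of_nonneg_left hbig' hη0.le
    have h5 : η * (M / η + 1) = M + η := by field_simp
    linarith

/-- Joint continuity of the two-variable evaluation `mmEval u w` on `ℂ[u][w]`. -/
theorem tendsto_mmEval (P : Polynomial (Polynomial ℂ)) {u w : ℕ → ℂ} {u₀ w₀ : ℂ}
    (hu : Tendsto u atTop (𝓝 u₀)) (hw : Tendsto w atTop (𝓝 w₀)) :
    Tendsto (fun n => mmEval (u n) (w n) P) atTop (𝓝 (mmEval u₀ w₀ P)) := by
  have h : ∀ a b : ℂ, mmEval a b P =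
      ∑ i ∈ Finset.range (P.natDegree + 1), (P.coeff i).eval a * b ^ i := by
    intro a b
    rw [mmEval_eq_eval₂, Polynomial.eval₂_eq_sum_range]
    rfl
  simp only [h]
  refine tendsto_finsetSum _ fun i _ => ?_
  exact (((P.coeff i).continuous.tendsto u₀).comp hu).mul (hw.pow i)

/-- **A polynomial in `ℂ[u][x]` vanishing at `(α, Λ(α) + 2πik)` for all `α` in an infinite set and
all `k ∈ ℤ` is zero**: for fixed `α` infinitely many roots in `x`, then infinitely many roots in
`u` for each coefficient. -/
theorem eq_zero_of_forall_mmEval_shift_eq_zero (H : Polynomial (Polynomial ℂ)) {A : Set ℂ}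
    (hA : A.Infinite) (Λ : ℂ → ℂ)
    (h : ∀ α ∈ A, ∀ k : ℤ, mmEval α (Λ α + (k : ℂ) * (2 * Real.pi * I)) H = 0) : H = 0 := by
  have hα : ∀ α ∈ A, H.map (Polynomial.evalRingHom α) = 0 := by
    intro α hα
    refine Polynomial.eq_zero_of_infinite_isRoot _ ?_
    have hinj : Function.Injective fun k : ℤ => Λ α + (k : ℂ) * (2 * Real.pi * I) := by
      intro k₁ k₂ hk
      have h1 := add_left_cancel hk
      have h2 := mul_right_cancel₀ two_pi_I_ne_zero h1
      exact_mod_cast h2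
    refine (Set.infinite_range_of_injective hinj).mono ?_
    rintro _ ⟨k, rfl⟩
    simp only [Set.mem_setOf_eq, Polynomial.IsRoot, Polynomial.eval_map]
    rw [← mmEval_eq_eval₂]
    exact h α hα k
  refine Polynomial.ext fun i => ?_
  rw [Polynomial.coeff_zero]
  refine Polynomial.eq_zero_of_infinite_isRoot _ (hA.mono fun α hαA => ?_)
  have h1 := congrArg (fun P => Polynomial.coeff P i) (hα α hαA)
  simpa [Polynomial.coeff_map] using h1

end Elimination

/-! ## Density for the split 3-folds -/

section Density

/-- **THEOREM (Zariski density, totally real plane × graph curve).**  `r₁` irrational, `q₀, q₁ ≠ 0`,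
`r₀ deg q₀ + r₁ deg q₁ ≠ 1` ⟹ the exponential points of
`W = {x₂ = r₀ x₀ + r₁ x₁ + c, y₀ = q₀(y₂), y₁ = q₁(y₂)}` are Zariski dense in `W`. -/
theorem unprojectedDense_realSplit_two (r : Fin 2 → ℝ) (hr : Irrational (r 1)) (c : ℂ)
    {q : Fin 2 → Polynomial ℂ} (hq : ∀ j, q j ≠ 0)
    (hdeg : ∑ j, r j * ((q j).natDegree : ℝ) ≠ 1) :
    UnprojectedDense (graphFibreVariety (∑ j, C (r j : ℂ) * X j + C c)
        (fun j => Polynomial.aeval (X 0 : MvPolynomial (Fin 3) ℂ) (q j))) := by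
  classical
  set W := graphFibreVariety (∑ j, C (r j : ℂ) * X j + C c)
        (fun j => Polynomial.aeval (X 0 : MvPolynomial (Fin 3) ℂ) (q j)) with hW
  -- membership dictionary
  have hmem : ∀ z : Fin 3 ⊕ Fin 3 → ℂ, z ∈ W ↔
      z (Sum.inl 2) = (r 0 : ℂ) * z (Sum.inl 0) + (r 1 : ℂ) * z (Sum.inl 1) + c ∧
        z (Sum.inr 0) = (q 0).eval (z (Sum.inr 2)) ∧ z (Sum.inr 1) = (q 1).eval (z (Sum.inr 2)) := by
    intro z
    rw [hW, mem_graphFibreVariety_iff]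
    simp only [eval_polynomial_aeval_X, Fin.cons_zero, map_add, map_mul, eval_C, eval_X,
      Fin.sum_univ_two, Fin.forall_fin_two]
    rfl
  -- the parametrisation `(x₀, x₁, u) ↦` point of `W`
  set pt : ℂ → ℂ → ℂ → Fin 3 ⊕ Fin 3 → ℂ := fun u a z =>
    Sum.elim ![a, z, (r 0 : ℂ) * a + (r 1 : ℂ) * z + c] ![(q 0).eval u, (q 1).eval u, u] with hpt
  have hptW : ∀ u a z, pt u a z ∈ W := by
    intro u a z
    rw [hmem]
    simp [hpt]
  have hptΓ : ∀ u a z, exp a = (q 0).eval u → exp z = (q 1).eval u →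
      exp ((r 0 : ℂ) * a + (r 1 : ℂ) * z + c) = u → pt u a z ∈ expGraph ℂ 3 := by
    intro u a z h0 h1 h2
    rw [mem_expGraph_iff]
    intro i
    fin_cases i <;> simp [hpt, ExponentialRing.complex_exp_eq, h0, h1, h2]
  have hpt_of_mem : ∀ w ∈ W, pt (w (Sum.inr 2)) (w (Sum.inl 0)) (w (Sum.inl 1)) = w := by
    intro w hw
    obtain ⟨h1, h2, h3⟩ := (hmem w).1 hw
    funext i
    rcases i with i | i <;> fin_cases i <;> simp [hpt, h1, h2, h3]
  -- the pull-back to `ℂ[u][x₀][x₁]`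
  set CCC : ℂ →+* Polynomial (Polynomial (Polynomial ℂ)) :=
    Polynomial.C.comp (Polynomial.C.comp Polynomial.C) with hCCC
  set usym : Polynomial (Polynomial (Polynomial ℂ)) := Polynomial.C (Polynomial.C Polynomial.X)
    with husym
  set asym : Polynomial (Polynomial (Polynomial ℂ)) := Polynomial.C Polynomial.X with hasym
  set σ : Fin 3 ⊕ Fin 3 → Polynomial (Polynomial (Polynomial ℂ)) :=
    Sum.elim ![asym, Polynomial.X, CCC (r 0 : ℂ) * asym + CCC (r 1 : ℂ) * Polynomial.X + CCC c]
      ![Polynomial.C (Polynomial.C (q 0)), Polynomial.C (Polynomial.C (q 1)), usym] with hσ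
  set ev : ℂ → ℂ → ℂ → Polynomial (Polynomial (Polynomial ℂ)) →+* ℂ := fun u a z =>
    Polynomial.eval₂RingHom (mmEval u a) z with hev
  have hevC : ∀ u a z, (ev u a z).comp CCC = RingHom.id ℂ := by
    intro u a z
    ext t
    simp [hev, hCCC, mmEval]
  have hevσ : ∀ u a z, (fun i => ev u a z (σ i)) = pt u a z := by
    intro u a z
    funext i
    rcases i with i | i <;> fin_cases i <;>
      simp [hev, hσ, hpt, hasym, husym, hCCC, mmEval]
  -- the density argument
  refine le_antisymm ?_ (vanishingIdeal_anti_mono Set.inter_subset_left)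
  intro F hF
  set G : Polynomial (Polynomial (Polynomial ℂ)) := MvPolynomial.eval₂Hom CCC σ F with hG
  have hGeval : ∀ u a z, ev u a z G = MvPolynomial.eval (pt u a z) F := by
    intro u a z
    have h1 := DFunLike.congr_fun (MvPolynomial.comp_eval₂Hom CCC σ (ev u a z)) F
    rw [RingHom.comp_apply, hevC, hevσ] at h1
    rw [hG, h1]
    rfl
  -- a level point and the shifted core with escaping coordinate `j₀ = 1`
  obtain ⟨u₀, hu₀, hqu₀, hlev⟩ := exists_splitLevelPoint r c hq hdeg
  obtain ⟨A, Λ, hA, hcore⟩ := realSplit_core_shift r (j₀ := 1) hr c hdeg hu₀ hqu₀ hlev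
  have hG0 : G = 0 := by
    by_contra hGne
    have hlc : G.leadingCoeff ≠ 0 := Polynomial.leadingCoeff_ne_zero.2 hGne
    refine hlc (eq_zero_of_forall_mmEval_shift_eq_zero _ hA (Λ 0) fun α hα k => ?_)
    obtain ⟨x, w, hx1, hw, hxlim, hpts⟩ := hcore α hα ![k, 0]
    have hx0 : Tendsto (fun n => x n 0) atTop (𝓝 (Λ 0 α + (k : ℂ) * (2 * Real.pi * I))) := by
      have := hxlim 0 (by decide)
      simpa using this
    refine map_leadingCoeff_eq_zero_of_eval₂_eq_zero G (fun n => mmEval (w n) (x n 0))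
      (mmEval α (Λ 0 α + (k : ℂ) * (2 * Real.pi * I))) (fun P => tendsto_mmEval P hw hx0)
      (fun n => x n 1) hx1 fun n => ?_
    have h2 := hGeval (w n) (x n 0) (x n 1)
    simp only [hev, Polynomial.coe_eval₂RingHom] at h2
    rw [h2]
    refine eval_eq_zero_of_mem_vanishingIdeal hF ⟨hptW _ _ _,
      hptΓ _ _ _ ((hpts n).1 0) ((hpts n).1 1) ?_⟩
    have := (hpts n).2
    simpa [Fin.sum_univ_two] using this
  refine mem_vanishingIdeal_of_eval fun s hs => ?_
  have h := hGeval (s (Sum.inr 2)) (s (Sum.inl 0)) (s (Sum.inl 1))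
  rw [hG0, map_zero, hpt_of_mem s hs] at h
  exact h.symm

/-- **The aperiodic model is dense**: the exponential points of
`{x₂ = √2 x₀ + √3 x₁, y₀ = y₂ + 1, y₁ = y₂² - 2} ⊆ ℂ³ × ℂ³` — a member of the APERIODIC piece of
`EC(3,2)` (`1, √2, √3` are `ℚ`-independent) — are Zariski dense. -/
theorem unprojectedDense_sqrt_two_sqrt_three_split :
    UnprojectedDense (graphFibreVariety
      (∑ j, C ((![Real.sqrt 2, Real.sqrt 3] j : ℝ) : ℂ) * X j + C 0)
      (fun j => Polynomial.aeval (X 0 : MvPolynomial (Fin 3) ℂ)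
        ((![Polynomial.X + Polynomial.C 1, Polynomial.X ^ 2 - Polynomial.C 2] :
          Fin 2 → Polynomial ℂ) j))) := by
  refine unprojectedDense_realSplit_two _ (by simpa using Nat.prime_three.irrational_sqrt) 0
    (fun j => ?_) ?_
  · fin_cases j
    · intro h
      have := congrArg (Polynomial.eval (0 : ℂ)) h
      norm_num at this
    · intro h
      have := congrArg (Polynomial.eval (0 : ℂ)) h
      norm_num at this
  · have h1 : (Polynomial.X + Polynomial.C (1 : ℂ)).natDegree = 1 := Polynomial.natDegree_X_add_C 1
    have h2 : (Polynomial.X ^ 2 - Polynomial.C (2 : ℂ)).natDegree = 2 := by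
      rw [sub_eq_add_neg, ← Polynomial.C_neg, Polynomial.natDegree_X_pow_add_C]
    rw [Fin.sum_univ_two]
    simp only [Matrix.cons_val_zero, Matrix.cons_val_one, h1, h2,
      Nat.cast_one, mul_one, Nat.cast_ofNat]
    have h3 : (1 : ℝ) < Real.sqrt 3 := by
      rw [show (1 : ℝ) = Real.sqrt 1 by simp]
      exact Real.sqrt_lt_sqrt (by norm_num) (by norm_num)
    nlinarith [Real.sqrt_nonneg 2]

/-- **The periodic model is dense**: the exponential points of
`{x₂ = √2 x₀ + √2 x₁, y₀ = y₂ - 3, y₁ = y₂ + 5}` — a member of the PERIODIC piece of `EC(3,2)`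
(period `(1,-1,0)`) — are Zariski dense. -/
theorem unprojectedDense_sqrt_two_periodic_split :
    UnprojectedDense (graphFibreVariety
      (∑ j, C ((![Real.sqrt 2, Real.sqrt 2] j : ℝ) : ℂ) * X j + C 0)
      (fun j => Polynomial.aeval (X 0 : MvPolynomial (Fin 3) ℂ)
        ((![Polynomial.X - Polynomial.C 3, Polynomial.X + Polynomial.C 5] :
          Fin 2 → Polynomial ℂ) j))) := by
  refine unprojectedDense_realSplit_two _ (by simpa using irrational_sqrt_two) 0
    (fun j => ?_) ?_
  · fin_cases j
    · exact Polynomial.X_sub_C_ne_zero 3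
    · intro h
      have := congrArg (Polynomial.eval (0 : ℂ)) h
      norm_num at this
  · have h1 : (Polynomial.X - Polynomial.C (3 : ℂ)).natDegree = 1 := Polynomial.natDegree_X_sub_C 3
    have h2 : (Polynomial.X + Polynomial.C (5 : ℂ)).natDegree = 1 := Polynomial.natDegree_X_add_C 5
    rw [Fin.sum_univ_two]
    simp only [Matrix.cons_val_zero, Matrix.cons_val_one, h1, h2, Nat.cast_one, mul_one]
    intro h
    have h4 : Real.sqrt 2 = 1 / 2 := by linarith
    exact irrational_sqrt_two.ne_rational 1 2 (by rw [h4]; norm_num)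

end Density

end Summit.Schanuel.Schanuel.Theorems

end
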